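/- Copyright: the b2b-balaban cell (near-miss cell 7), T⁴-continuum fan-out, lineage t4-ne7b-p1 (node U5c COUNT
member).  Released under the licence of the surrounding project. -/
import Summits.QuantumFields.BalabanUV.T4Continuum.Support.HistoryRealisePrint

/-!
# Realised histories, MEMORY-AGNOSTIC FORM (repair core R-41-a of the located model finding F-ne7bleaf01g24-1): the
renewal clause asks only what the count consumes — condition (i) at the readiness index and pendency before it — so
that NO READINESS CONVENTION (frozen memory, current memory, any memory bounded by the frozen one) enters the carriers
(owner module of row NE7b, lineage `t4-ne7b-p1` gen 41, ruling R-OWNER-41-1; sibling of row S1b's `HistoryRealise`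
(leaf-08, p209120) and of the print-exact core `HistoryRealisePrint` (owner, p246311), which it imports and does not
modify)

Summits-side support leaf of the T⁴-continuum cell (rung (B)+1 on a FINITE torus only; NOT infinite volume, NOT the
mass gap, NOT the Clay statement; NOT a proof of the spine estimate NE7b, which is the cell's OWN estimate, NOT PRINTED
and NOT PROVED).  [folklore] finite combinatorics in the ℤᵈ index model over `HistoryRealise` ∕ `HistoryRealisePrint`
(`orbit`, `Stops`, `PendingAt`, `PendingBefore`, `Realises`, `RealisesP`) and `HistoryWindows`; nothing printed is
asserted, no `def … : Prop` fact of Bałaban's, no cite-tagged hypothesis, zero `sorry`.  B15 = [Balaban1989LargeFieldI]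
pp. 177, 198 and B16 = [Balaban1989LargeFieldII] pp. 383–387 are manuscripts UNDER AUDIT; the sentences quoted LOCATE
the construction steps the clauses transcribe (renders re-read as images by the owner 2026-08-21, journal R-OWNER-41-1).

WHY (the located finding, MODEL side — nothing here says print is wrong).  Row S1b's `Stops L s R t₀ Z k := StopAt 100
(R t₀) ⊤ (orbit …) k` reads condition (ii)'s memory `N` at the LAST EVENT `t₀` of the line and keeps it; print reads it
at the level at which the readiness test is made: «the domain S^K(Z), considered as a domain in the lattice of the
scale L^{−(j+K)}, satisfies the conditions (i), (ii), with N = R_j» for «Z a component of Z_j» (B16 p. 384, the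
statement re-made at every level through (1.83)); «the last product is over components of Z_j satisfying the
conditions (i), (ii), for which some large fields are created during the preparatory steps» (p. 383, under (1.79));
«These two conditions can be satisfied by N to the positive power of log g_k^{−2}» (B15 p. 198, `k` the level the
𝐑-operation acts on); and «in some steps the number R_k decreases by the factor L^{−1}» (B15 p. 177).  The two
readings agree while `R` is constant on a line's quiet interval and differ across a drop.  Rather than twin the whole
carrier chain for the current-memory convention, THIS FILE removes the convention from the realisation predicate: a
RENEWAL at `h + 1` of a line with last event `t` is realised iff `t < h`, the line's image at `h` satisfies condition
(i) (`CondI 100`), the line did NOT stop (frozen memory `R t`) at any index `< h − t`, and the new domain is the image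
at `h + 1`.  Every readiness convention whose memory at relative index `k` is at most `R t` (frozen: `= R t`; print's
current: `R (t + k) ≤ R t` for non-increasing `R`) implies these three facts, and they are exactly what row S1b's
window argument consumes (`stopAt_restart` needs condition (i) at `h − t` only; `renew_lt_reach` needs pendency before
`h` only).  Birth and join clauses are `RealisesP`'s, token for token.

WHAT IS DEFINED AND PROVED.  §1 **`RealisesW L s R : PGen (Pt d × Finset (Pt d)) → Finset (Pt d) → Prop`**;
**`realisesW_of_realisesP`**, `realisesW_of_realises` (the landed predicates imply the weak one); `realisesW_renew_of_stopAt`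
(a renewal justified by a stop for ANY memory, plus frozen pendency before, is `RealisesW`-realised — the lemma every
convention instantiates).  §2 **`exists_stop_lt_reach_W`** (every `RealisesW`-realised history stops strictly inside its
booked life — the print-exact core's proof verbatim, the renewal case reading `t < h` and condition (i) off the clause).
§3 the displays: **`lt_reach_of_pendingBefore_W`**, `lt_reach_of_pendingAt_W`, `renew_lt_reach_W`, `joinInLife_of_realisesW`,
`adm_of_realisesW`.  §4 root anchors: `rootAnchor_mem_rootRegion_W`, `rootAnchor_ne_of_disjoint_W`, `rootRegion_faceConnected_W`, `rootStep_le_lastStep_of_realisesW`.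
§5 sanity: the unit region is `RealisesW`-realised; a numeric instance of `exists_stop_lt_reach_W`; the abstract shape
of a renewal that is `RealisesW`- but not `RealisesP`-realisable (condition (i) at `h` without a frozen-memory stop there).

HONEST.  MODEL repair core only: the carriers `RealisedDomains*P` ∕ `RealisedReading*P` and the ENDs still quote
`RealisesP` (their W-twins are the downstream half of R-41-a — INTERFACE REQUESTS IR-41-4∕-5∕-6, not here); located open
point G-M4-1 (fresh touching clusters: the birth clause still asks `FaceConnected`) untouched; NE7b NOT proved; spine
0∕9.  HONEST DEPENDENCY (cell): continuum YM on T⁴ ⇐ BetaPertH ∧ nine spine estimates (0/9 proved); BetaPertH ⇐ (D1) ∧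
(D4) ∧ CAP+tail; G-an2-4 gates asym, D1 and NE2/3/4.  This file changes none of it. -/

open Finset
open Literature.MathematicalPhysics.QuantumFieldTheory.Balaban1983to89
open Literature.MathematicalPhysics.QuantumFieldTheory.Balaban1983to89.B13ScaleTransfer
open Literature.MathematicalPhysics.QuantumFieldTheory.Balaban1983to89.TreeLength
open Literature.MathematicalPhysics.QuantumFieldTheory.Balaban1983to89.B16SProfile
open Literature.MathematicalPhysics.QuantumFieldTheory.Balaban1983to89.B16StoppingRule
open Literature.MathematicalPhysics.QuantumFieldTheory.Balaban1983to89.B16MergeGeometry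
open Literature.MathematicalPhysics.QuantumFieldTheory.Balaban1983to89.B16MergeHorizon
open T4PersistenceDictionary
open Summit.QuantumFields.BalabanUV.T4Continuum.HistoryAdmissible
open Summit.QuantumFields.BalabanUV.T4Continuum.HistoryWindows
open Summit.QuantumFields.BalabanUV.T4Continuum.HistoryRealise
open Summit.QuantumFields.BalabanUV.T4Continuum.HistoryRealisePrint

namespace Summit.QuantumFields.BalabanUV.T4Continuum.HistoryRealiseWeak

noncomputable section

variable {d : ℕ}

/-! ## §1 Realised histories with the memory-agnostic renewal clause -/

/-- **REALISED HISTORIES, MEMORY-AGNOSTIC FORM.**  A NEW REGION (anchor ∈ region, face-connected, class `≥ treeLen`);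
a RENEWAL at `h + 1` of a line with last event `t < h` whose image at `h` satisfies condition (i) (`CondI 100`), which
did not stop (frozen memory) at any index `< h − t`, the new domain being the image at `h + 1`; a JOIN at `s` of two
lines with `lastStep ≤ s`, neither having stopped at any scale strictly before `s`, whose current images touch, the
joined domain inside their union ((1.84)) — the join and birth clauses are `RealisesP`'s. [folklore] -/
def RealisesW (L : ℕ) (s : ℕ → ℕ) (R : ℕ → ℕ) : PGen (Pt d × Finset (Pt d)) → Finset (Pt d) → Prop
  | .birth _ cls zZ, Z => zZ.2 = Z ∧ zZ.1 ∈ Z ∧ FaceConnected Z ∧ treeLen Z ≤ cls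
  | .renew G h, Z => ∃ ZG, RealisesW L s R G ZG ∧ G.lastStep < h ∧
      CondI 100 (orbit L s G.lastStep ZG (h - G.lastStep)) ∧
      (∀ k, k < h - G.lastStep → ¬ Stops L s R G.lastStep ZG k) ∧ Z = orbit L s G.lastStep ZG (h + 1 - G.lastStep)
  | .join X Y sj, Z => ∃ ZX ZY, RealisesW L s R X ZX ∧ RealisesW L s R Y ZY ∧ X.lastStep ≤ sj ∧ Y.lastStep ≤ sj ∧
      PendingBefore L s R X.lastStep ZX sj ∧ PendingBefore L s R Y.lastStep ZY sj ∧
      (∃ a ∈ orbit L s X.lastStep ZX (sj - X.lastStep), ∃ c ∈ orbit L s Y.lastStep ZY (sj - Y.lastStep), Touch a c) ∧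
      Z ⊆ orbit L s X.lastStep ZX (sj - X.lastStep) ∪ orbit L s Y.lastStep ZY (sj - Y.lastStep)

/-- **THE PRINT-EXACT PREDICATE IMPLIES THE MEMORY-AGNOSTIC ONE** (a frozen-memory stop at `h − t` gives `t < h` and
condition (i) there). [folklore] -/
theorem realisesW_of_realisesP {L : ℕ} {s R : ℕ → ℕ} :
    ∀ (P : PGen (Pt d × Finset (Pt d))) (Z : Finset (Pt d)), RealisesP L s R P Z → RealisesW L s R P Z
  | .birth _ _ _, _, h => h
  | .renew G h, Z, hP => by
      obtain ⟨ZG, hG, hready, hfirst, hZ⟩ := hP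
      have := hready.pos
      exact ⟨ZG, realisesW_of_realisesP G ZG hG, by omega, hready.condI, hfirst, hZ⟩
  | .join X Y sj, Z, hP => by
      obtain ⟨ZX, ZY, hX, hY, htX, htY, hpX, hpY, hac, hZ⟩ := hP
      exact ⟨ZX, ZY, realisesW_of_realisesP X ZX hX, realisesW_of_realisesP Y ZY hY, htX, htY, hpX, hpY, hac, hZ⟩

/-- row S1b's predicate implies the memory-agnostic one [folklore] -/
theorem realisesW_of_realises {L : ℕ} {s R : ℕ → ℕ} (P : PGen (Pt d × Finset (Pt d))) (Z : Finset (Pt d))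
    (h : Realises L s R P Z) : RealisesW L s R P Z :=
  realisesW_of_realisesP P Z (realisesP_of_realises P Z h)

/-- **THE LEMMA EVERY READINESS CONVENTION INSTANTIATES**: a renewal at `h + 1` of a `RealisesW`-realised line with last
event `t`, justified by a stop of its orbit at `h − t` for ANY memory `N` (any cleanliness predicate), together with
frozen-memory pendency before `h`, is `RealisesW`-realised by the image at `h + 1`. [folklore] -/
theorem realisesW_renew_of_stopAt {L : ℕ} {s R : ℕ → ℕ} {G : PGen (Pt d × Finset (Pt d))} {ZG : Finset (Pt d)}
    (hG : RealisesW L s R G ZG) {h N : ℕ} {Clean : ℕ → Prop}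
    (hstop : StopAt 100 N Clean (orbit L s G.lastStep ZG) (h - G.lastStep))
    (hfirst : ∀ k, k < h - G.lastStep → ¬ Stops L s R G.lastStep ZG k) :
    RealisesW L s R (.renew G h) (orbit L s G.lastStep ZG (h + 1 - G.lastStep)) := by
  have hpos : 0 < h - G.lastStep := hstop.1
  exact ⟨ZG, hG, by omega, hstop.2.1, hfirst, rfl⟩

/-- the renewal clause read back: last event strictly before the readiness scale [folklore] -/
theorem lastStep_lt_of_realisesW_renew {L : ℕ} {s R : ℕ → ℕ} {G : PGen (Pt d × Finset (Pt d))} {h : ℕ}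
    {Z : Finset (Pt d)} (hP : RealisesW L s R (.renew G h) Z) : G.lastStep < h := by
  obtain ⟨-, -, ht, -, -, -⟩ := hP
  exact ht

/-! ## §2 Every weakly realised history stops, strictly inside its booked life -/

section Main

variable {L : ℕ} {s R : ℕ → ℕ} (hL : 4 ≤ L) (hdrop : ∀ m, DropCtl s m) (hR : ∀ t, 1 ≤ R t) {n₁ : ℕ} (hn₁ : 13 ≤ n₁)
include hL hdrop hR hn₁

/-- **MAIN THEOREM, MEMORY-AGNOSTIC FORM.**  Every `RealisesW`-realised history STOPS at some `k ≥ 1` with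
`lastStep + k < toGen.reach (dictW R n₁)` (`L ≥ 4`, drop control, sizes `R ≥ 1`, allowance `n₁ ≥ 13`).  The
print-exact core's proof verbatim: the renewal case reads `t < h` and condition (i) at `h − t` off the clause (that is
all `HistoryWindows.stopAt_restart` consumes); the join case with its `K₁ = 0` boundary partners is unchanged.
[folklore] -/
theorem exists_stop_lt_reach_W :
    ∀ (P : PGen (Pt d × Finset (Pt d))) (Z : Finset (Pt d)), RealisesW L s R P Z →
      ∃ k, 1 ≤ k ∧ Stops L s R P.lastStep Z k ∧ P.lastStep + k < P.toGen.reach (dictW R n₁)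
  | .birth j cls zZ, Z, hRZ => exists_stop_lt_reach hL hdrop hR hn₁ (.birth j cls zZ) Z hRZ
  | .renew G h, Z, hRZ => by
      obtain ⟨ZG, -, ht, hI, -, rfl⟩ := hRZ
      set t := G.lastStep with ht_def
      -- restart from the readiness scale `h − t` of the old line, memory `R (h+1)`: condition (i) at `h − t` is all
      -- that is consumed
      have hrs := stopAt_restart (show 3 ≤ L by omega) (dropCtl_from hdrop t (h - t + 1 + R (h + 1)))
        (X := orbit L s t ZG) (fun l => orbit_succ L s t ZG l) hI (hR (h + 1)) (fun _ => True)
        (fun _ _ _ => trivial) le_rfl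
      refine ⟨R (h + 1), hR (h + 1), ?_, ?_⟩
      · show StopAt 100 (R (h + 1)) (fun _ => True) (orbit L s (h + 1) (orbit L s t ZG (h + 1 - t))) (R (h + 1))
        obtain ⟨-, hI', -, hall⟩ := hrs
        have hsh : ∀ l, orbit L s (h + 1) (orbit L s t ZG (h + 1 - t)) l = orbit L s t ZG (h - t + 1 + l) := by
          intro l
          rw [show h - t + 1 + l = (h + 1 - t) + l by omega, orbit_add, show t + (h + 1 - t) = h + 1 by omega]
        refine ⟨hR (h + 1), ?_, le_rfl, fun l h1 h2 => ⟨trivial, ?_⟩⟩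
        · rw [hsh]; exact hI'
        · rw [hsh]; exact (hall (h - t + 1 + l) (by omega) (by omega)).2
      · have h1 := restart_lt_dictW R n₁ (h + 1)
        simp only [PGen.lastStep, PGen.toGen, Gen.reach_renew]
        omega
  | .join X Y sj, Z, hRZ => by
      obtain ⟨ZX, ZY, hX, hY, htX, htY, hpX, hpY, ⟨a, ha, c, hc, hac⟩, hZ⟩ := hRZ
      obtain ⟨kX, hkX1, hsX, hrX⟩ := exists_stop_lt_reach_W X ZX hX
      obtain ⟨kY, hkY1, hsY, hrY⟩ := exists_stop_lt_reach_W Y ZY hY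
      set tX := X.lastStep
      set tY := Y.lastStep
      -- partners pending STRICTLY BEFORE the join: their stops lie AT or after `sj`
      have hKX : sj - tX ≤ kX := by
        by_contra hlt; exact hpX.2 kX (by omega) hsX
      have hKY : sj - tY ≤ kY := by
        by_contra hlt; exact hpY.2 kY (by omega) hsY
      -- condition (i) of the partners at own indices `K₁ = tX + kX − sj`, `K₂ = tY + kY − sj` from the join scale
      have hXI : CondI 100 (Siter (ratio L fun i => s (sj + i)) (tX + kX - sj) (orbit L s tX ZX (sj - tX))) := by
        have h := hsX.condI
        rw [show kX = (sj - tX) + (tX + kX - sj) by omega, orbit_add, show tX + (sj - tX) = sj by omega] at h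
        exact h
      have hYI : CondI 100 (Siter (ratio L fun i => s (sj + i)) (tY + kY - sj) (orbit L s tY ZY (sj - tY))) := by
        have h := hsY.condI
        rw [show kY = (sj - tY) + (tY + kY - sj) by omega, orbit_add, show tY + (sj - tY) = sj by omega] at h
        exact h
      have hreach : ∀ {k K₁ K₂ : ℕ}, k ≤ max K₁ K₂ + 13 + R sj → sj + K₁ < X.toGen.reach (dictW R n₁) →
          sj + K₂ < Y.toGen.reach (dictW R n₁) →
          (PGen.join X Y sj).lastStep + k < (PGen.join X Y sj).toGen.reach (dictW R n₁) := by
        intro k K₁ K₂ hk h₁ h₂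
        have h := join_lt_dictW R hn₁ sj hk h₁ h₂
        simp only [PGen.lastStep, PGen.toGen, Gen.reach_merge]
        exact h
      by_cases h1 : tX + kX - sj = 0
      · -- `X`'s image satisfies (i) AT the join scale (print's K₁ = 0 partner, p. 387)
        have hXI0 : CondI 100 (orbit L s tX ZX (sj - tX)) := by rw [h1] at hXI; simpa using hXI
        have hnear := near_of_condI_touch hXI0 ha hac
        have hst := stopAt_union (show 2 ≤ L by omega)
          (dropCtl_from hdrop sj (max (tY + kY - sj + 6) 14 + R sj - 1)) hc (D := 100) (by norm_num) (by norm_num)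
          hnear hYI (hR sj) (fun _ => True) (fun _ _ _ => trivial) le_rfl
        refine ⟨max (tY + kY - sj + 6) 14 + R sj - 1, by omega, ?_, hreach (K₁ := 0) (K₂ := tY + kY - sj)
          (by omega) (by omega) (by omega)⟩
        apply Stops.subset hZ
        show StopAt 100 (R sj) (fun _ => True)
          (orbit L s sj (orbit L s tX ZX (sj - tX) ∪ orbit L s tY ZY (sj - tY))) _
        exact hst
      · by_cases h2 : tY + kY - sj = 0
        · -- the symmetric boundary case: `Y`'s image satisfies (i) at the join scale
          have hYI0 : CondI 100 (orbit L s tY ZY (sj - tY)) := by rw [h2] at hYI; simpa using hYI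
          have hnear := near_of_condI_touch hYI0 hc hac.symm
          have hst := stopAt_union (show 2 ≤ L by omega)
            (dropCtl_from hdrop sj (max (tX + kX - sj + 6) 14 + R sj - 1)) ha (D := 100) (by norm_num) (by norm_num)
            hnear hXI (hR sj) (fun _ => True) (fun _ _ _ => trivial) le_rfl
          refine ⟨max (tX + kX - sj + 6) 14 + R sj - 1, by omega, ?_, hreach (K₁ := tX + kX - sj) (K₂ := 0)
            (by omega) (by omega) (by omega)⟩
          apply Stops.subset hZ
          show StopAt 100 (R sj) (fun _ => True)
            (orbit L s sj (orbit L s tX ZX (sj - tX) ∪ orbit L s tY ZY (sj - tY))) _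
          rw [Finset.union_comm]
          exact hst
        · -- both partners stop strictly after the join scale: `stopAt_join`
          obtain ⟨k, hk1, hkle, hstop⟩ := stopAt_join (show 2 ≤ L by omega)
            (dropCtl_from hdrop sj (max (tX + kX - sj) (tY + kY - sj) + 13 + R sj)) ha hc hac (by omega) (by omega)
            hXI hYI (hR sj) (fun _ => True) (fun _ _ _ => trivial) le_rfl
          refine ⟨k, hk1, ?_, hreach hkle (by omega) (by omega)⟩
          apply Stops.subset hZ
          show StopAt 100 (R sj) (fun _ => True)
            (orbit L s sj (orbit L s tX ZX (sj - tX) ∪ orbit L s tY ZY (sj - tY))) k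
          exact hstop

/-! ## §3 The displays of row S1b, re-derived for the memory-agnostic clauses -/

/-- **PENDING STRICTLY BEFORE THE CUTOFF ⇒ INSIDE THE BOOKED LIFE**: `K < toGen.reach (dictW R n₁)` — the SAME
conclusion as `lt_reach_of_pendingAt` ∕ `lt_reach_of_pendingBefore`, for weakly realised histories. [folklore] -/
theorem lt_reach_of_pendingBefore_W {P : PGen (Pt d × Finset (Pt d))} {Z : Finset (Pt d)} (hP : RealisesW L s R P Z)
    {K : ℕ} (hK : PendingBefore L s R P.lastStep Z K) : K < P.toGen.reach (dictW R n₁) := by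
  obtain ⟨k, -, hs, hlt⟩ := exists_stop_lt_reach_W hL hdrop hR hn₁ P Z hP
  have : K - P.lastStep ≤ k := by
    by_contra hlt'; exact hK.2 k (by omega) hs
  have := hK.1
  omega

/-- the same from pendency THROUGH the cutoff (the stronger clause of row S1b's carriers) [folklore] -/
theorem lt_reach_of_pendingAt_W {P : PGen (Pt d × Finset (Pt d))} {Z : Finset (Pt d)} (hP : RealisesW L s R P Z)
    {K : ℕ} (hK : PendingAt L s R P.lastStep Z K) : K < P.toGen.reach (dictW R n₁) :=
  lt_reach_of_pendingBefore_W hL hdrop hR hn₁ hP (pendingBefore_of_pendingAt hK)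

/-- a renewal happens strictly inside the booked life of the renewed line (pendency before `h` is all that is used)
[folklore] -/
theorem renew_lt_reach_W {G : PGen (Pt d × Finset (Pt d))} {h : ℕ} {Z : Finset (Pt d)}
    (hP : RealisesW L s R (.renew G h) Z) : h < G.toGen.reach (dictW R n₁) := by
  obtain ⟨ZG, hG, ht, -, hfirst, -⟩ := hP
  obtain ⟨k, -, hs, hlt⟩ := exists_stop_lt_reach_W hL hdrop hR hn₁ G ZG hG
  have : h - G.lastStep ≤ k := by
    by_contra hlt'; exact hfirst k (by omega) hs
  omega

/-- **`JoinInLife` DERIVED** for weakly realised histories. [folklore] -/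
theorem joinInLife_of_realisesW :
    ∀ (P : PGen (Pt d × Finset (Pt d))) (Z : Finset (Pt d)), RealisesW L s R P Z → P.JoinInLife (dictW R n₁)
  | .birth _ _ _, _, _ => trivial
  | .renew G h, Z, hP => by
      obtain ⟨ZG, hG, -, -, -, -⟩ := hP
      exact joinInLife_of_realisesW G ZG hG
  | .join X Y sj, Z, hP => by
      obtain ⟨ZX, ZY, hX, hY, -, -, hpX, hpY, -, -⟩ := hP
      exact ⟨joinInLife_of_realisesW X ZX hX, joinInLife_of_realisesW Y ZY hY,
        lt_reach_of_pendingBefore_W hL hdrop hR hn₁ hX hpX, lt_reach_of_pendingBefore_W hL hdrop hR hn₁ hY hpY⟩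

end Main

/-- **`Adm` DERIVED** for weakly realised histories. [folklore] -/
theorem adm_of_realisesW {L : ℕ} {s R : ℕ → ℕ} :
    ∀ (P : PGen (Pt d × Finset (Pt d))) (Z : Finset (Pt d)), RealisesW L s R P Z → ∀ {K : ℕ}, P.lastStep ≤ K → P.Adm K
  | .birth _ _ _, _, _, _, hK => hK
  | .renew G h, Z, hP, K, hK => by
      obtain ⟨ZG, hG, ht, -, -, -⟩ := hP
      simp only [PGen.lastStep] at hK
      exact ⟨adm_of_realisesW G ZG hG (by omega), by omega, hK⟩
  | .join X Y sj, Z, hP, K, hK => by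
      obtain ⟨ZX, ZY, hX, hY, htX, htY, -, -, -, -⟩ := hP
      exact ⟨adm_of_realisesW X ZX hX (htX.trans hK), adm_of_realisesW Y ZY hY (htY.trans hK), htX, htY, hK⟩

/-- the last event of a weakly realised history is at most any scale it is admissible for (read back from `Adm`)
[folklore] -/
theorem rootStep_le_lastStep_of_realisesW {L : ℕ} {s R : ℕ → ℕ} {P : PGen (Pt d × Finset (Pt d))} {Z : Finset (Pt d)}
    (hP : RealisesW L s R P Z) : P.rootStep ≤ P.lastStep :=
  (adm_of_realisesW P Z hP le_rfl).rootStep_le_lastStep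

/-! ## §4 Root anchors and root regions -/

/-- in a weakly realised history the root anchor lies in the root region [folklore] -/
theorem rootAnchor_mem_rootRegion_W {L : ℕ} {s R : ℕ → ℕ} :
    ∀ (P : PGen (Pt d × Finset (Pt d))) (Z : Finset (Pt d)), RealisesW L s R P Z → rootAnchor P ∈ rootRegion P
  | .birth _ _ zZ, Z, hP => by
      obtain ⟨hZ, hz, -, -⟩ := hP
      simpa [rootAnchor, rootRegion, PGen.rootCell, hZ] using hz
  | .renew G h, Z, hP => by
      obtain ⟨ZG, hG, -, -, -, -⟩ := hP
      exact rootAnchor_mem_rootRegion_W G ZG hG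
  | .join X Y sj, Z, hP => by
      obtain ⟨ZX, ZY, hX, hY, -, -, -, -, -, -⟩ := hP
      unfold rootAnchor rootRegion
      simp only [PGen.rootCell]
      split_ifs
      · exact rootAnchor_mem_rootRegion_W X ZX hX
      · exact rootAnchor_mem_rootRegion_W Y ZY hY

/-- root-cell distinctness of disjoint root regions, memory-agnostic form [folklore] -/
theorem rootAnchor_ne_of_disjoint_W {L : ℕ} {s R : ℕ → ℕ} {P P' : PGen (Pt d × Finset (Pt d))} {Z Z' : Finset (Pt d)}
    (hP : RealisesW L s R P Z) (hP' : RealisesW L s R P' Z') (hdis : Disjoint (rootRegion P) (rootRegion P')) :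
    rootAnchor P ≠ rootAnchor P' := fun h =>
  Finset.disjoint_left.1 hdis (rootAnchor_mem_rootRegion_W P Z hP) (h ▸ rootAnchor_mem_rootRegion_W P' Z' hP')

/-- the root region of a weakly realised history is face-connected (the birth clause carried to the root) [folklore] -/
theorem rootRegion_faceConnected_W {L : ℕ} {s R : ℕ → ℕ} :
    ∀ (P : PGen (Pt d × Finset (Pt d))) (Z : Finset (Pt d)), RealisesW L s R P Z → FaceConnected (rootRegion P)
  | .birth _ cls zZ, Z, hP => by
      obtain ⟨hZ, -, hc, -⟩ := hP
      simpa [rootRegion, PGen.rootCell, hZ] using hc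
  | .renew G h, Z, hP => by
      obtain ⟨ZG, hG, -, -, -, -⟩ := hP
      exact rootRegion_faceConnected_W G ZG hG
  | .join X Y sj, Z, hP => by
      obtain ⟨ZX, ZY, hX, hY, -, -, -, -, -, -⟩ := hP
      unfold rootRegion
      simp only [PGen.rootCell]
      split_ifs
      · exact rootRegion_faceConnected_W X ZX hX
      · exact rootRegion_faceConnected_W Y ZY hY

/-! ## §5 Sanity -/

namespace Sanity

open B16MergeGeometry.OneDim

/-- row S1b's unit region is weakly realised (births are verbatim) [folklore] -/
theorem realisesW_unit (L : ℕ) (s R : ℕ → ℕ) : RealisesW L s R HistoryRealise.Sanity.unit {pt 0} :=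
  realisesW_of_realises _ _ (HistoryRealise.Sanity.realises_unit L s R)

/-- hence (constant flow, sizes `2`, allowance `13`) it stops strictly inside its booked life `4` [folklore] -/
example : ∃ k, 1 ≤ k ∧ Stops 4 (fun _ => 0) (fun _ => 2) 0 ({pt 0} : Finset (Pt 1)) k ∧ 0 + k < 4 := by
  have h := exists_stop_lt_reach_W (d := 1) (L := 4) (s := fun _ => 0) (R := fun _ => 2) le_rfl
    (fun m => B16Absorption.dropCtl_const 0 m) (fun _ => by norm_num) (n₁ := 13) le_rfl HistoryRealise.Sanity.unit
    {pt 0} (realisesW_unit 4 _ _)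
  simpa [HistoryRealise.Sanity.unit, PGen.lastStep, PGen.toGen, dictW, fatWait] using h

/-- THE SHAPE OF THE FINDING, in the abstract: a renewal justified by a SHORTER-memory stop at `h − t` (any `N`) with no
frozen-memory stop strictly before is `RealisesW`-realised — whether or not the frozen-memory stop holds AT `h − t`
(`StopAt` is a hypothesis; no geometry is decided here). [folklore] -/
example {L : ℕ} {s R : ℕ → ℕ} {G : PGen (Pt d × Finset (Pt d))} {ZG : Finset (Pt d)} (hG : RealisesW L s R G ZG)
    {h N : ℕ} (hstop : StopAt 100 N (fun _ => True) (orbit L s G.lastStep ZG) (h - G.lastStep))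
    (hfirst : ∀ k, k < h - G.lastStep → ¬ Stops L s R G.lastStep ZG k) :
    RealisesW L s R (.renew G h) (orbit L s G.lastStep ZG (h + 1 - G.lastStep)) :=
  realisesW_renew_of_stopAt hG hstop hfirst

end Sanity

end

end Summit.QuantumFields.BalabanUV.T4Continuum.HistoryRealiseWeak
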